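import Literature.Barriers.AtomisticToContinuum.AnticontinuumLocalizationCancellation
import HarnessLib

/-!
# De Roeck–Huveneers 2015, Theorem 1 on SHORT chains, I: the objects, the identity, and `A = 0`

`Literature/Barriers/AtomisticToContinuum/` — a companion to the formalisation of §§3–5 of
W. De Roeck, F. Huveneers, *Asymptotic localization of energy in nondisordered oscillator chains*,
CPAM **68** (2015), arXiv:1305.5127 (`…NormalForm`, `…Cutoffs`, `…Solution`, `…ZeroSet`,
`…Cancellation`, …). The printed proof of Theorem 1 treats long chains: its Lemma 4 (§5.5) needs
`n₂` well separated sites near the bond ("By taking `n₃` large enough, we can find `n₂` linearly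
independent vectors"), whence the tree's `DeRoeckHuveneers2015_thm1_largeN` (`N ≥ N₀(γ, T, n)`).
This file starts the complementary SHORT-CHAIN case (a window of `m` sites, `m` small), which the
source does not treat, by a variant of §5 that needs no room. It is not taken from the source;
every ingredient is the source's (§3 scheme and Prop. 1, §4.2 Prop. 2, §5.4 crucial cancellation),
and the observation is:

* **(no multi-resonances on a short chain)** if the cut-offs are built with `n₂ > m`, the
  multi-resonance sets `S(x)` of Prop. 2 are EMPTY — `S(x)` carries `n₂` linearly independent
  mode vectors in `ℝ^m` (`ResonanceCutoffs.multiRes_subset`), impossible for `n₂ > m`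
  (`ResonanceCutoffs.multiRes_eq_empty`); hence the second item of Prop. 2 holds at EVERY momentum:
  `k·∇_ω θ_x(ω) = 0` for every `2δ`-resonant `k ∈ K_r`, everywhere.
* **(the short-chain splitting)** replace the partition-of-unity splitting of §5.1 by
  `F = θ_b · H̃_{>b}` (`sgtPoly`: componentwise `θ_b(ω) H̃^{(j)}_{>b}`), and set, exactly as in §5.2,
  `U = H^O_{>b} - 𝒯(R F)` (`U0S`), `A = 𝒯(R(H̃ · F))` (`AtermS`), `B = {V, (R F)_n}` (`BtermS`),
  `G = ε^{-(n₀+1)}(A + ε^{n+1} B)` (`G0S`). Proposition 1 (second point, `liouville_eval_rOp`) holds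
  for every truncated series, so **`ε J_{b,b+1} = L_H U + ε^{n₀+1} G`** (`current_identityS`).
* **(`A = 0` identically)** the coefficient `l` of `H̃ · F` is
  `∑_{i+j=l} (θ_b {H̃^{(i)}, H̃^{(j)}_{>b}} + H̃^{(j)}_{>b} {H̃^{(i)}, θ_b})`; the first sum vanishes
  by the crucial cancellation of §5.4 where `θ_b > 0` (`cancellation`) and trivially where
  `θ_b = 0`; each `{H̃^{(i)}, θ_b}` vanishes termwise — a non-resonant resonant term is locally `0`,
  a resonant one differentiates `θ_b` along its mode, which is `0` since `S(b) = ∅`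
  (`poisson_term_comp_snd_eq_zero`). Hence every coefficient of `H̃ · F` vanishes
  (`mulS_coeff_eq_zero`), and so does `A` (`AtermS_eq_zero`): on a short chain
  `ε J = L_H U + ε^{n-n₀} B` with NO resonant remainder.

The price is locality (the tail `H̃_{>b}` is not localised near `b`), which is void on a short
chain: all constants may depend on `m`. The bounds on `U`, `B` and the window-solution packaging
are in the follow-up files. All proved; no named facts.
[cite: DeRoeckHuveneers2015, §3.2 Prop. 1, §4.2 Prop. 2, §5.1–5.2, §5.4, §5.5 Lemma 4]
-/

noncomputable section

open Function Set Finset Filter Metric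
open scoped ContDiff BigOperators Topology

namespace Literature.Barriers.AtomisticToContinuum.HeatConduction.RotorChain

open Literature.MathematicalPhysics.KineticTheory.HeatConduction
open Literature.Analysis.Calculus Literature.Analysis.Calculus.IsDeltaSymbol
open Literature.Algebra.Lie Literature.Algebra.Lie.TruncSeries

variable {m : ℕ}

/-! ### No multi-resonances on a short chain -/

/-- **On a window of `m < n₂` sites the multi-resonance sets `S(x)` are empty**: `S(x)` would carry
`n₂` linearly independent vectors of `ℝ^m`. (Not in the source, which works at `N ≫ n₂`.)
[cite: DeRoeckHuveneers2015, §4.2 (definition of `S_{δ,n₂}(x)`: "a cluster `{k_1, …, k_{n₂}}` around `x`" of linearly independent vectors)] -/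
theorem ResonanceCutoffs.multiRes_eq_empty {r L n₂ : ℕ} (Θ : ResonanceCutoffs m r L n₂) (hm : m < n₂)
    {δ : ℝ} (hδ : 0 < δ) (hδ1 : δ ≤ 1) (x : Fin m) : Θ.multiRes x δ = ∅ := by
  ext w
  simp only [Set.mem_empty_iff_false, iff_false]
  intro hw
  obtain ⟨ks, hli, -⟩ := Θ.multiRes_subset δ hδ hδ1 x w hw
  have h := hli.fintype_card_le_finrank
  rw [Fintype.card_fin, Module.finrank_fin_fun] at h
  omega

/-- Pointwise form: no momentum is multi-resonant. [folklore] -/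
theorem ResonanceCutoffs.not_mem_multiRes {r L n₂ : ℕ} (Θ : ResonanceCutoffs m r L n₂) (hm : m < n₂)
    {δ : ℝ} (hδ : 0 < δ) (hδ1 : δ ≤ 1) (x : Fin m) (w : Fin m → ℝ) : w ∉ Θ.multiRes x δ := by
  rw [Θ.multiRes_eq_empty hm hδ hδ1 x]; exact Set.notMem_empty w

/-! ### The short-chain splitting `F = θ_b · H̃_{>b}` -/

section Objects

variable {r L n₂ : ℕ} (Θ : ResonanceCutoffs m r L n₂) (b : Fin m) (γ : ℝ) (n : ℕ)

/-- **`F^{(j)} = θ_b · H̃^{(j)}_{>b}`**: the tail of the perturbative Hamiltonian beyond the bond,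
switched off at resonant momenta near `b` (the short-chain substitute for `H̃_{>a}` of §5.1).
[cite: DeRoeckHuveneers2015, §5.1 (definition of `H̃_{>a}`), here with the single cut-off `θ_b` in place of the partition `ϑ_{a,x}, ϑ_*`] -/
def sgtPoly (j : ℕ) : TrigPoly m :=
  TrigPoly.smulFun (Θ.θ b) (tailP b (normalForm m γ n j))

variable {Θ b γ n}

/-- `ev F^{(j)} = θ_b(ω) · ev H̃^{(j)}_{>b}`. [folklore] -/
theorem ev_sgtPoly (j : ℕ) (δ : ℝ) (z : PhaseSpace m) :
    TrigPoly.ev (sgtPoly Θ b γ n j) δ z = Θ.θ b δ z.2 * TrigPoly.ev (tailP b (normalForm m γ n j)) δ z := by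
  unfold sgtPoly; rw [TrigPoly.ev_smulFun]

/-- `F^{(j)}` is good (local within the working radius, smooth) at scales `δ ∈ (0, 1]`. [folklore] -/
theorem sgtPoly_good {δ : ℝ} (hδ : 0 < δ) (hδ1 : δ ≤ 1) {j : ℕ} (hj : j ≤ n) :
    (sgtPoly Θ b γ n j).Good (bigRad m n) δ := by
  have hF := normalForm_good_bigRad (m := m) γ n δ hj
  have htriv : ∀ t ∈ (normalForm m γ n j).filter (fun t => decide (b < t.pos)), ∀ δ',
      DependsOn (Θ.θ b δ') (siteBall t.pos (bigRad m n)) := by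
    intro t _ δ'
    refine (dependsOn_univ _).mono fun y _ => ?_
    rw [mem_siteBall]
    have h1 := t.pos.isLt; have h2 := y.isLt
    unfold Nat.dist bigRad; omega
  exact (hF.filter _).smulFun htriv (Θ.contDiff hδ hδ1 b)

variable (Θ b γ n) in
/-- **`F` as a truncated series of smooth functions** (at scales `δ ∈ (0,1]`; `0` otherwise). [folklore] -/
def sgtTS (δ : ℝ) : TruncSeries (SmoothFun m) n :=
  TruncSeries.mk (fun j => if h : (0 < δ ∧ δ ≤ 1) ∧ j ≤ n then
      SmoothFun.mk (TrigPoly.ev (sgtPoly Θ b γ n j) δ) (sgtPoly_good h.1.1 h.1.2 h.2).contDiff_ev else 0)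
    (fun _ hk => dif_neg fun h => absurd h.2 (not_le.2 hk))

/-- Coefficients of `sgtTS` at a good scale. [folklore] -/
theorem val_sgtTS_coeff {δ : ℝ} (hδ : 0 < δ) (hδ1 : δ ≤ 1) {j : ℕ} (hj : j ≤ n) :
    ((sgtTS Θ b γ n δ).coeff j).val = TrigPoly.ev (sgtPoly Θ b γ n j) δ := by
  rw [sgtTS, TruncSeries.coeff_mk, dif_pos ⟨⟨hδ, hδ1⟩, hj⟩, SmoothFun.val_mk]

/-- `sgtPoly` represents `sgtTS`. [folklore] -/
theorem sgt_represents {δ : ℝ} (hδ : 0 < δ) (hδ1 : δ ≤ 1) :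
    SymSeries.Represents δ n (sgtPoly Θ b γ n) (sgtTS Θ b γ n δ) :=
  fun _ hj => val_sgtTS_coeff hδ hδ1 hj

variable (Θ b γ n) in
/-- **`U = H^O_{>b} - 𝒯_n(R F)`** (the short-chain `U_b`; no centring is needed for the identity).
[cite: DeRoeckHuveneers2015, §5.2 (definition of `U_a`), with `F = θ_b H̃_{>b}` for `H̃_{>a}`] -/
def U0S (ε δ : ℝ) (z : PhaseSpace m) : ℝ :=
  tailEnergy m ε γ (b.val + 1) z -
    (TruncSeries.eval ε (TruncSeries.rOp (genFun m γ n δ) n (sgtTS Θ b γ n δ))).val z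

variable (Θ b γ n) in
/-- **The resonant term `A = 𝒯_n(R(H̃ · F))`** (shown below to vanish identically on a short chain).
[cite: DeRoeckHuveneers2015, §5.2 (the term `𝒯_{n₁}(R L_H̃ H̃_{>a})` of `ε^{n₀+1}G_a`)] -/
def AtermS (ε δ : ℝ) (z : PhaseSpace m) : ℝ :=
  (TruncSeries.eval ε (TruncSeries.rOp (genFun m γ n δ) n
      (TruncSeries.qOp (genFun m γ n δ) n (hamTS m γ n) * sgtTS Θ b γ n δ))).val z

variable (Θ b γ n) in
/-- **The truncation term `B = {V, (R F)_n}`.** [cite: DeRoeckHuveneers2015, §5.2 (the term `ε^{n₁+1} L_V ∑_k R^{(n₁-k)} H̃^{(k)}_{>a}` of `ε^{n₀+1}G_a`)] -/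
def BtermS (δ : ℝ) (z : PhaseSpace m) : ℝ :=
  poisson (potentialEnergy m γ) ((TruncSeries.rOp (genFun m γ n δ) n (sgtTS Θ b γ n δ)).coeff n).val z

variable (Θ b γ n) in
/-- **`G = ε^{-(n₀+1)}(A + ε^{n+1} B)`.** [cite: DeRoeckHuveneers2015, §5.2 (definition of `G_a`)] -/
def G0S (n₀ : ℕ) (ε δ : ℝ) (z : PhaseSpace m) : ℝ :=
  (ε ^ (n₀ + 1))⁻¹ * (AtermS Θ b γ n ε δ z + ε ^ (n + 1) * BtermS Θ b γ n δ z)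

/-! ### The identity -/

/-- **`ε J_{b,b+1} = L_H U + (A + ε^{n+1} B)`** — from `L_H H^O_{>b} = εJ` and the second point of
Proposition 1 applied to `f = F`. [cite: DeRoeckHuveneers2015, §3.2 Prop. 1 and §5.2 (first display)] -/
theorem current_eq_liouville_U0S_add {n : ℕ} (hn : 1 ≤ n) (ε γ δ : ℝ) (z : PhaseSpace m) :
    ε * bondCurrent m b z = liouville m ε γ (U0S Θ b γ n ε δ) z +
      (AtermS Θ b γ n ε δ z + ε ^ (n + 1) * BtermS Θ b γ n δ z) := by
  have hP := liouville_eval_rOp (m := m) hn ε γ δ (sgtTS Θ b γ n δ) z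
  have hT := liouville_tailEnergy (m := m) ε γ b z
  have hsub : liouville m ε γ (U0S Θ b γ n ε δ) z =
      liouville m ε γ (tailEnergy m ε γ (b.val + 1)) z -
        liouville m ε γ (TruncSeries.eval ε (TruncSeries.rOp (genFun m γ n δ) n (sgtTS Θ b γ n δ))).val z := by
    unfold U0S liouville
    exact poisson_sub_right _ ((contDiff_tailEnergy m ε γ _).differentiable (by simp)) (differentiable_val _) z
  rw [hsub, hT, hP]
  unfold AtermS BtermS
  ring

/-- **`ε J = L_H U + ε^{n₀+1} G`** (`ε ≠ 0`). [cite: DeRoeckHuveneers2015, §2.3 Thm 1 and §5.2] -/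
theorem current_identityS {n : ℕ} (hn : 1 ≤ n) (n₀ : ℕ) {ε : ℝ} (hε : ε ≠ 0) (γ δ : ℝ) (z : PhaseSpace m) :
    ε * bondCurrent m b z = liouville m ε γ (U0S Θ b γ n ε δ) z + ε ^ (n₀ + 1) * G0S Θ b γ n n₀ ε δ z := by
  rw [current_eq_liouville_U0S_add (Θ := Θ) (b := b) hn ε γ δ z, G0S, ← mul_assoc,
    mul_inv_cancel₀ (pow_ne_zero _ hε), one_mul]

/-! ### `A = 0` on a short chain -/

/-- **`{H̃^{(i)}, θ_b}(q, ω) = 0` at every multi-resonance-free momentum** (so everywhere on a short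
chain): termwise, a non-resonant resonant term is locally zero and a resonant one differentiates
`θ_b` along its own mode. [cite: DeRoeckHuveneers2015, §4.3 proof of Prop. 2, second item ("It is thus enough to show that `k·∇_ω θ_x(ω) = 0` …")] -/
theorem poisson_normalForm_theta_eq_zero {δ : ℝ} (hδ : 0 < δ) (hδ1 : δ ≤ 1) (hr : IsSchemeRadius n r) {i : ℕ}
    (hi : i ≤ n) {w : Fin m → ℝ} (hw : ∀ y, w ∉ Θ.multiRes y δ) (q : Fin m → ℝ) :
    poisson (TrigPoly.ev (normalForm m γ n i) δ) (fun z : PhaseSpace m => Θ.θ b δ z.2) (q, w) = 0 := by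
  have hdiff : Differentiable ℝ (Θ.θ b δ) := (Θ.contDiff hδ hδ1 b).differentiable (by simp)
  rw [poisson_ev_left (normalForm m γ n i) (stage_good m γ n δ n i hi).2 (fun z : PhaseSpace m => Θ.θ b δ z.2)]
  refine list_sum_map_eq_zero fun t ht => ?_
  exact poisson_term_comp_snd_eq_zero (Θ := Θ) (b := b) (n₃ := 0) hδ hδ1 hr hi ht hdiff
    (fun k _ _ hθ => hθ b (self_mem_nearSites b 0)) (fun y _ => hw y) q

/-- **Every coefficient of `H̃ · F` vanishes** at multi-resonance-free momenta (so identically on a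
short chain): `∑_{i+j=l} {H̃^{(i)}, θ_b H̃^{(j)}_{>b}} = θ_b ∑_{i+j=l}{H̃^{(i)}, H̃^{(j)}_{>b}} +
∑ H̃^{(j)}_{>b}{H̃^{(i)}, θ_b} = 0 + 0` by the crucial cancellation (where `θ_b > 0`) and the previous
lemma. [cite: DeRoeckHuveneers2015, §5.4 (crucial cancellation) and §5.5 Lemma 4, first claim] -/
theorem mulS_coeff_eq_zero {δ : ℝ} (hδ : 0 < δ) (hδ1 : δ ≤ 1) (hr : IsSchemeRadius n r)
    {w : Fin m → ℝ} (hw : ∀ y, w ∉ Θ.multiRes y δ) (q : Fin m → ℝ) (l : ℕ) :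
    ((TruncSeries.qOp (genFun m γ n δ) n (hamTS m γ n) * sgtTS Θ b γ n δ).coeff l).val (q, w) = 0 := by
  by_cases hl : l ≤ n
  swap
  · rw [TruncSeries.coeff_eq_zero _ (not_le.1 hl)]; rfl
  rw [TruncSeries.coeff_mul_of_le _ _ hl, SmoothFun.val_sum]
  dsimp only
  simp only [SmoothFun.val_lie]
  have hred : ∀ p ∈ antidiagonal l,
      poisson ((TruncSeries.qOp (genFun m γ n δ) n (hamTS m γ n)).coeff p.1).val ((sgtTS Θ b γ n δ).coeff p.2).val (q, w) =
      Θ.θ b δ w * poisson (TrigPoly.ev (normalForm m γ n p.1) δ) (TrigPoly.ev (tailP b (normalForm m γ n p.2)) δ) (q, w) := by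
    intro p hp
    have hp' := Finset.mem_antidiagonal.1 hp
    have hp1 : p.1 ≤ n := by omega
    have hp2 : p.2 ≤ n := by omega
    rw [normalForm_represents m γ n δ p.1 hp1, val_sgtTS_coeff hδ hδ1 hp2]
    have hT : Differentiable ℝ (TrigPoly.ev (tailP b (normalForm m γ n p.2)) δ) :=
      TrigPoly.differentiable_ev _ fun s hs => ((((stage_good m γ n δ n _ hp2).filter _).2) s hs).differentiable
    have hth : Differentiable ℝ (fun z : PhaseSpace m => Θ.θ b δ z.2) :=
      ((Θ.contDiff hδ hδ1 b).differentiable (by simp)).comp differentiable_snd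
    have e1 : TrigPoly.ev (sgtPoly Θ b γ n p.2) δ =
        (fun z : PhaseSpace m => Θ.θ b δ z.2) * TrigPoly.ev (tailP b (normalForm m γ n p.2)) δ := by
      funext z; rw [ev_sgtPoly]; rfl
    rw [e1, poisson_mul_right _ hth hT, poisson_normalForm_theta_eq_zero hδ hδ1 hr hp1 hw q, mul_zero, add_zero]
  rw [Finset.sum_congr rfl hred, ← Finset.mul_sum]
  by_cases hv : Θ.θ b δ w = 0
  · rw [hv, zero_mul]
  · have hpos : 0 < Θ.θ b δ w := lt_of_le_of_ne (Θ.nonneg b δ w) (Ne.symm hv)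
    rw [cancellation hδ hr hl (Θ.nonres_of_pos δ hδ hδ1 b w hpos) q, mul_zero]

/-- **`A = 0` at multi-resonance-free momenta** (propagation through `R` and `𝒯`, which only see
gradients). [cite: DeRoeckHuveneers2015, §5.6 ("`L_H̃ H̃_{>a}` vanishes on the open set `Ω ∖ Z`, so that `∂_♯𝒯_{n₁}(R L_H̃ H̃_{>a})` vanishes on this set as well")] -/
theorem AtermS_eq_zero_of_forall {δ : ℝ} (hδ : 0 < δ) (hδ1 : δ ≤ 1) (hr : IsSchemeRadius n r)
    (hS : ∀ (y : Fin m) (w : Fin m → ℝ), w ∉ Θ.multiRes y δ) (ε : ℝ) (z : PhaseSpace m) :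
    AtermS Θ b γ n ε δ z = 0 := by
  have hX : ∀ j, VanishesOff (∅ : Set (Fin m → ℝ))
      ((TruncSeries.qOp (genFun m γ n δ) n (hamTS m γ n) * sgtTS Θ b γ n δ).coeff j) := by
    intro j z' _
    have := mulS_coeff_eq_zero (Θ := Θ) (b := b) (γ := γ) hδ hδ1 hr (fun y => hS y z'.2) z'.1 j
    simpa using this
  exact (VanishesOff.rOp isClosed_empty (genFun m γ n δ) n hX |> VanishesOff.eval ε) z (Set.notMem_empty _)

/-- **On a short chain (`m < n₂`) the resonant term vanishes identically: `A = 0`.** [cite: DeRoeckHuveneers2015, §5.5 Lemma 4, first claim (its short-chain form: `Z` is never met)] -/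
theorem AtermS_eq_zero (hm : m < n₂) {δ : ℝ} (hδ : 0 < δ) (hδ1 : δ ≤ 1) (hr : IsSchemeRadius n r)
    (ε : ℝ) (z : PhaseSpace m) : AtermS Θ b γ n ε δ z = 0 :=
  AtermS_eq_zero_of_forall hδ hδ1 hr (fun y w => Θ.not_mem_multiRes hm hδ hδ1 y w) ε z

/-- Hence on a short chain `G = ε^{n-n₀} B` (`ε ≠ 0`). [folklore] -/
theorem G0S_eq (hm : m < n₂) {δ : ℝ} (hδ : 0 < δ) (hδ1 : δ ≤ 1) (hr : IsSchemeRadius n r) (n₀ : ℕ)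
    (ε : ℝ) (z : PhaseSpace m) :
    G0S Θ b γ n n₀ ε δ z = (ε ^ (n₀ + 1))⁻¹ * (ε ^ (n + 1) * BtermS Θ b γ n δ z) := by
  rw [G0S, AtermS_eq_zero hm hδ hδ1 hr, zero_add]

/-- **The short-chain decomposition of the current**: for `m < n₂`, `n ≥ 1`, `ε ≠ 0` and
`δ ∈ (0, 1]`, `ε J_{b,b+1} = L_H U + ε^{n+1} B` exactly — no resonant remainder. [cite: DeRoeckHuveneers2015, §2.3 Thm 1 (short chains, not treated in the source)] -/
theorem current_identityS_short (hm : m < n₂) {n : ℕ} (hn : 1 ≤ n) (hr : IsSchemeRadius n r) (ε γ : ℝ)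
    {δ : ℝ} (hδ : 0 < δ) (hδ1 : δ ≤ 1) (z : PhaseSpace m) :
    ε * bondCurrent m b z = liouville m ε γ (U0S Θ b γ n ε δ) z + ε ^ (n + 1) * BtermS Θ b γ n δ z := by
  rw [current_eq_liouville_U0S_add (Θ := Θ) (b := b) hn ε γ δ z, AtermS_eq_zero hm hδ hδ1 hr, zero_add]

end Objects

end Literature.Barriers.AtomisticToContinuum.HeatConduction.RotorChain

end
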